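import Mathlib.CategoryTheory.Conj
import Mathlib.CategoryTheory.Endomorphism
import Literature.AnabelianGeometry.SemiGraphs.UniversalCoveringOverDeck
import Literature.AnabelianGeometry.SemiGraphs.OrbitGraphMap
import Literature.AnabelianGeometry.SemiGraphs.OrbitGraphOrbits
import Literature.AnabelianGeometry.SemiGraphs.UniversalCoveringTree
import Literature.AnabelianGeometry.SemiGraphs.SemiGraphIsoTransport
import HarnessLib

/-!
# The underlying semi-graph of `𝒢_{∞,S}` is the universal graph-covering `𝔾̃_S` ([SemiAnbd] §3 p. 38)

Mochizuki, *Semi-graphs of anabelioids*, Publ. RIMS **42** (2006), §3, proof of Prop. 3.6, author's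
manuscript p. 38 [cite: MochizukiSemiAnbd2006, Prop 3.6 p.38]: "`𝒢_{∞,i} → 𝒢_i` for the covering of
`𝒢_i` determined by the *universal graph-covering* of the underlying semi-graph `𝔾_i` of `𝒢_i`", with
"`Gal(𝒢_{∞,i}/𝒢_i) ≅ π₁(𝔾_i)`"; and proof of Thm. 3.7 (iii), p. 41: `π₁^temp(𝒢)` "acts on each of the
`𝒢_{∞,i}`", whose underlying semi-graphs are TREES.  In the cell's rendering, `𝒢_{∞,S} = S.univCoverOver c` (`UniversalCoveringOver.lean`, seat
abc-iut-L3-t9) is an object of `B^cov(𝒢)` built fibrewise from the universal graph-covering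
`𝔾̃_S = S.orbitGraph.univCover c` (`UniversalCovering.lean`) of the underlying semi-graph
`𝔾_S = S.orbitGraph` (`OrbitGraph.lean`), and every object `T` of `B^cov(𝒢)` has an underlying semi-graph
`T.orbitGraph`, functorially (`OrbitGraphMap.lean`).  This file supplies the identification used when
`Aut(𝒢_{∞,S})` (hence `π₁^temp(𝒢) = lim Aut(𝒢_{∞,i})`) is made to act on the trees (interface
`TemperedLevelData.lean`, fields `tree`/`isTree`/`act`/`quot`):

* `SemiGraph.deckAut`; `CovObj.orbitGraphMap_id` / `_comp`, `orbitGraphFunctor 𝒢 : CovObj 𝒢 ⥤ SemiGraph`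
  — the underlying semi-graph is a functor (so `Functor.mapAut` gives `Aut T →* Aut T.orbitGraph`);
* `CovObj.univCoverOverToUnivCover : (S.univCoverOver c h𝒢).orbitGraph ⟶ S.orbitGraph.univCover c`
  (the orbit of `(V, x, p)` ↦ `(V, p)`), bijective, whence the isomorphism
  `CovObj.univCoverOverOrbitGraphIso : (S.univCoverOver c h𝒢).orbitGraph ≅ S.orbitGraph.univCover c`;
* naturality: over `𝔾_S` (`univCoverOverToUnivCover_comp_univCoverProj`), over `𝔾`
  (`univCoverOverToUnivCover_comp_proj`), and equivariance for the deck transformations of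
  `π₁(𝔾_S, c)` (`orbitGraphMap_deckOver_comp`; `autUnivCover_deckOverAut`);
* `CovObj.isTree_orbitGraph_univCoverOver` — the underlying semi-graph of `𝒢_{∞,S}` is a tree
  (`SemiGraph.univCover_isTree` transported).  Seat abc-iut-L3-t6, row «(B5) TREES = ORBIT GRAPHS»;
  generic tools in `SemiGraphIsoTransport.lean`.  Nothing here bears on [IUTchIII] Cor. 3.12.
-/

namespace Literature.AnabelianGeometry.SemiGraphs

open CategoryTheory

universe u

/-! ### Deck transformations as automorphisms -/

namespace SemiGraph

/-- The deck transformation of `γ ∈ π₁(𝔾, c₀)` as an automorphism of the universal graph-covering.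
[cite: MochizukiSemiAnbd2006, §1 p.15] -/
noncomputable def deckAut (G : SemiGraph.{u}) (c₀ : G.CatCarrier) (γ : G.FundamentalGroup c₀) :
    Aut (G.univCover c₀) where
  hom := G.deck c₀ γ
  inv := G.deck c₀ γ⁻¹
  hom_inv_id := by rw [← deck_mul, mul_inv_cancel, deck_one]
  inv_hom_id := by rw [← deck_mul, inv_mul_cancel, deck_one]

end SemiGraph

namespace ProfiniteSemiGraph

variable {𝒢 : ProfiniteSemiGraph.{u}}

/-! ### The underlying semi-graph is a functor `B^cov(𝒢) ⥤ SemiGraph` -/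

section Functor

variable {R T S : CovObj 𝒢}

/-- `OVertex.map` of the identity. [cite: MochizukiSemiAnbd2006, Def 3.5(i) p.37] -/
theorem CovObj.OVertex.map_id (V : T.OVertex) : CovObj.OVertex.map (𝟙 T) V = V := by
  induction V using Quot.ind with
  | mk q => rfl

/-- `OEdge.map` of the identity. [cite: MochizukiSemiAnbd2006, Def 3.5(i) p.37] -/
theorem CovObj.OEdge.map_id (E : T.OEdge) : CovObj.OEdge.map (𝟙 T) E = E := by
  induction E using Quot.ind with
  | mk q => rfl

/-- `OVertex.map` of a composite. [cite: MochizukiSemiAnbd2006, Def 3.5(i) p.37] -/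
theorem CovObj.OVertex.map_comp (f : R ⟶ T) (g : T ⟶ S) (V : R.OVertex) :
    CovObj.OVertex.map (f ≫ g) V = CovObj.OVertex.map g (CovObj.OVertex.map f V) := by
  induction V using Quot.ind with
  | mk q => rfl

/-- `OEdge.map` of a composite. [cite: MochizukiSemiAnbd2006, Def 3.5(i) p.37] -/
theorem CovObj.OEdge.map_comp (f : R ⟶ T) (g : T ⟶ S) (E : R.OEdge) :
    CovObj.OEdge.map (f ≫ g) E = CovObj.OEdge.map g (CovObj.OEdge.map f E) := by
  induction E using Quot.ind with
  | mk q => rfl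

/-- The underlying semi-graph of the identity is the identity. [cite: MochizukiSemiAnbd2006, Def 3.5(i) p.37] -/
theorem CovObj.orbitGraphMap_id (T : CovObj 𝒢) :
    CovObj.orbitGraphMap (𝟙 T) = 𝟙 T.orbitGraph :=
  SemiGraph.hom_ext _ _ (funext fun V => CovObj.OVertex.map_id V)
    (funext fun E => CovObj.OEdge.map_id E)
    (funext fun p => Subtype.ext (Prod.ext rfl (CovObj.OEdge.map_id p.1.2)))

/-- The underlying semi-graph of a composite is the composite. [cite: MochizukiSemiAnbd2006, Def 3.5(i) p.37] -/
theorem CovObj.orbitGraphMap_comp (f : R ⟶ T) (g : T ⟶ S) :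
    CovObj.orbitGraphMap (f ≫ g) = CovObj.orbitGraphMap f ≫ CovObj.orbitGraphMap g :=
  SemiGraph.hom_ext _ _ (funext fun V => CovObj.OVertex.map_comp f g V)
    (funext fun E => CovObj.OEdge.map_comp f g E)
    (funext fun p => Subtype.ext (Prod.ext rfl (CovObj.OEdge.map_comp f g p.1.2)))

variable (𝒢) in
/-- **The underlying-semi-graph functor `B^cov(𝒢) ⥤ SemiGraph`, `S ↦ 𝔾_S`** ([SemiAnbd] §3 p. 37:
"we may associate, in a natural way, to any object of `B^cov(𝒢)` a morphism of countable semi-graphs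
of anabelioids"). [cite: MochizukiSemiAnbd2006, Def 3.5(i) p.37] -/
noncomputable def orbitGraphFunctor : CovObj 𝒢 ⥤ SemiGraph.{u} where
  obj T := T.orbitGraph
  map f := CovObj.orbitGraphMap f
  map_id T := CovObj.orbitGraphMap_id T
  map_comp f g := CovObj.orbitGraphMap_comp f g

/-- The action `Aut(T) → Aut(𝔾_T)` of automorphisms of a covering on its underlying semi-graph, on
`hom`s. [cite: MochizukiSemiAnbd2006, Def 3.5(i) p.37] -/
theorem orbitGraphFunctor_mapAut_hom (T : CovObj 𝒢) (σ : Aut T) :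
    ((orbitGraphFunctor 𝒢).mapAut T σ).hom = CovObj.orbitGraphMap σ.hom := rfl

end Functor

/-! ### The comparison `𝔾_{𝒢_{∞,S}} → 𝔾̃_S` -/

variable (S : CovObj 𝒢) (c : S.orbitGraph.CatCarrier) (h𝒢 : 𝒢.IsCountable)

/-- On vertex-orbits: the `Π_v`-orbit of `(V, x, p)` ↦ the vertex `(V, p)` of `𝔾̃_S` (`Π_v` moves only
the point `x`). [cite: MochizukiSemiAnbd2006, Prop 3.6 p.38] -/
def CovObj.univCoverOverVertex :
    (S.univCoverOver c h𝒢).OVertex → (S.orbitGraph.univCover c).Vertex :=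
  Quot.lift (fun q : Σ v : 𝒢.graph.Vertex, S.FibV c v =>
      (⟨q.2.1.1, q.2.2.2⟩ : Σ V : S.OVertex, (S.orbitGraph.basept c ⟶ S.orbitGraph.basept (Sum.inl V))))
    (by rintro _ _ ⟨v, g, t⟩; rfl)

/-- On edge-orbits: the `Π_e`-orbit of `(E, y, q)` ↦ the edge `(E, q)` of `𝔾̃_S`.
[cite: MochizukiSemiAnbd2006, Prop 3.6 p.38] -/
def CovObj.univCoverOverEdge :
    (S.univCoverOver c h𝒢).OEdge → (S.orbitGraph.univCover c).Edge :=
  Quot.lift (fun q : Σ e : 𝒢.graph.Edge, S.FibE c e =>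
      (⟨q.2.1.1, q.2.2.2⟩ : Σ E : S.OEdge, (S.orbitGraph.basept c ⟶ S.orbitGraph.basept (Sum.inr E))))
    (by rintro _ _ ⟨e, g, t⟩; rfl)

/-- The edge of `𝔾_S` under the image of an edge-orbit of `𝒢_{∞,S}` lies over the same edge of `𝔾`.
[cite: MochizukiSemiAnbd2006, Prop 3.6 p.38] -/
theorem CovObj.base_univCoverOverEdge (E : (S.univCoverOver c h𝒢).OEdge) :
    CovObj.OEdge.base S (S.univCoverOverEdge c h𝒢 E).1 =
      CovObj.OEdge.base (S.univCoverOver c h𝒢) E := by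
  induction E using Quot.ind with
  | mk q => exact q.2.1.2

/-- On branches: the branch over `b` of the orbit of `(E, y, q)` ↦ the branch over `(b, E)` of the
edge `(E, q)` of `𝔾̃_S`. [cite: MochizukiSemiAnbd2006, Prop 3.6 p.38] -/
def CovObj.univCoverOverBranch :
    (S.univCoverOver c h𝒢).orbitGraph.Branch → (S.orbitGraph.univCover c).Branch :=
  fun β => ⟨S.univCoverOverEdge c h𝒢 β.1.2,
    ⟨⟨(β.1.1, (S.univCoverOverEdge c h𝒢 β.1.2).1), (S.base_univCoverOverEdge c h𝒢 β.1.2).trans β.2⟩,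
      rfl⟩⟩

/-- The gluing of `𝒢_{∞,S}` along `b`, on points, is `glueOverFun`. [cite: MochizukiSemiAnbd2006, Prop 3.6 p.38] -/
theorem CovObj.univCoverOver_glue_apply (b : 𝒢.graph.Branch) (v : 𝒢.graph.Vertex)
    (h : 𝒢.graph.abuts b = some v) (t : S.FibE c (𝒢.graph.edgeOf b)) :
    ((S.univCoverOver c h𝒢).glue b v h).hom.hom.hom t = S.glueOverFun c b v h t := rfl

/-- The abutment, in `𝔾̃_S`, of the image of the branch over `b : e → v` of the orbit of a point `t`
of the edge fibre of `𝒢_{∞,S}`: it is the image of the orbit of the glued point.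
[cite: MochizukiSemiAnbd2006, Prop 3.6 p.38] -/
theorem CovObj.univCover_abuts_univCoverOverBranch (b : 𝒢.graph.Branch) (v : 𝒢.graph.Vertex)
    (hb : 𝒢.graph.abuts b = some v) (t : S.FibE c (𝒢.graph.edgeOf b))
    (H : CovObj.OEdge.base (S.univCoverOver c h𝒢) (Quot.mk _ ⟨𝒢.graph.edgeOf b, t⟩) =
      𝒢.graph.edgeOf b) :
    (S.orbitGraph.univCover c).abuts
        (S.univCoverOverBranch c h𝒢 ⟨(b, Quot.mk _ ⟨𝒢.graph.edgeOf b, t⟩), H⟩) =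
      some (S.univCoverOverVertex c h𝒢 (Quot.mk _ ⟨v, S.glueOverFun c b v hb t⟩)) :=
  SemiGraph.univCover_abuts_of_abuts S.orbitGraph c t.1.1 t.2.2 ⟨(b, t.1.1), t.1.2⟩ rfl _
    (S.orbitGraph_abuts_mk b v hb t.1 t.2.1.1 t.2.1.2)

/-- **The comparison morphism `𝔾_{𝒢_{∞,S}} → 𝔾̃_S`** from the underlying semi-graph of `𝒢_{∞,S}` to
the universal graph-covering of `𝔾_S`. [cite: MochizukiSemiAnbd2006, Prop 3.6 p.38] -/
noncomputable def CovObj.univCoverOverToUnivCover :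
    (S.univCoverOver c h𝒢).orbitGraph ⟶ S.orbitGraph.univCover c where
  vertexMap := S.univCoverOverVertex c h𝒢
  edgeMap := S.univCoverOverEdge c h𝒢
  branchMap := S.univCoverOverBranch c h𝒢
  edgeOf_branchMap _ := rfl
  branchMap_injOn := by
    rintro ⟨⟨b₁, E₁⟩, h₁⟩ ⟨⟨b₂, E₂⟩, h₂⟩ (hE : E₁ = E₂) hb
    subst hE
    have hb' : b₁ = b₂ :=
      congrArg (fun β : (S.orbitGraph.univCover c).Branch => β.2.1.1.1) hb
    subst hb'
    rfl
  abuts_branchMap := by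
    rintro ⟨⟨b, E⟩, hβ⟩ W hW
    obtain ⟨⟨e, t⟩, rfl⟩ := Quot.exists_rep E
    change e = 𝒢.graph.edgeOf b at hβ
    subst hβ
    rcases hab : 𝒢.graph.abuts b with _ | v
    · rw [(S.univCoverOver c h𝒢).orbitGraph_abuts_of_none b _ rfl hab] at hW
      exact absurd hW (Option.some_ne_none W).symm
    · rw [(S.univCoverOver c h𝒢).orbitGraph_abuts_of_abuts b _ rfl v hab,
        (S.univCoverOver c h𝒢).glueOpt_mk b v hab t] at hW
      rw [← Option.some.inj hW]
      exact S.univCover_abuts_univCoverOverBranch c h𝒢 b v hab t _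

/-- The comparison morphism is injective on vertices (two points of an orbit `V ⊆ S_v` differ by an
element of `Π_v`). [cite: MochizukiSemiAnbd2006, Prop 3.6 p.38] -/
theorem CovObj.univCoverOverVertex_injective :
    Function.Injective (S.univCoverOverVertex c h𝒢) := by
  intro W₁ W₂ h
  obtain ⟨⟨v₁, ⟨V₁, hV₁⟩, ⟨x₁, hx₁⟩, p₁⟩, rfl⟩ := Quot.exists_rep W₁
  obtain ⟨⟨v₂, ⟨V₂, hV₂⟩, ⟨x₂, hx₂⟩, p₂⟩, rfl⟩ := Quot.exists_rep W₂
  change (⟨V₁, p₁⟩ : Σ V : S.OVertex, (S.orbitGraph.basept c ⟶ S.orbitGraph.basept (Sum.inl V))) =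
    ⟨V₂, p₂⟩ at h
  obtain ⟨rfl, hp⟩ := Sigma.mk.inj_iff.mp h
  obtain rfl := eq_of_heq hp
  subst hV₁
  cases hV₂
  obtain ⟨g, rfl⟩ := S.exists_ρ_of_mk_eq_mk (hx₁.trans hx₂.symm)
  exact Quot.sound (CovObj.VRel.mk _ g _)

/-- The comparison morphism is surjective on vertices. [cite: MochizukiSemiAnbd2006, Prop 3.6 p.38] -/
theorem CovObj.univCoverOverVertex_surjective :
    Function.Surjective (S.univCoverOverVertex c h𝒢) := by
  rintro ⟨V, p⟩
  obtain ⟨⟨v, x⟩, rfl⟩ := Quot.exists_rep V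
  exact ⟨Quot.mk _ ⟨v, ⟨⟨Quot.mk _ ⟨v, x⟩, rfl⟩, ⟨x, rfl⟩, p⟩⟩, rfl⟩

/-- The comparison morphism is injective on edges. [cite: MochizukiSemiAnbd2006, Prop 3.6 p.38] -/
theorem CovObj.univCoverOverEdge_injective :
    Function.Injective (S.univCoverOverEdge c h𝒢) := by
  intro W₁ W₂ h
  obtain ⟨⟨e₁, ⟨E₁, hE₁⟩, ⟨y₁, hy₁⟩, p₁⟩, rfl⟩ := Quot.exists_rep W₁
  obtain ⟨⟨e₂, ⟨E₂, hE₂⟩, ⟨y₂, hy₂⟩, p₂⟩, rfl⟩ := Quot.exists_rep W₂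
  change (⟨E₁, p₁⟩ : Σ E : S.OEdge, (S.orbitGraph.basept c ⟶ S.orbitGraph.basept (Sum.inr E))) =
    ⟨E₂, p₂⟩ at h
  obtain ⟨rfl, hp⟩ := Sigma.mk.inj_iff.mp h
  obtain rfl := eq_of_heq hp
  subst hE₁
  cases hE₂
  obtain ⟨g, rfl⟩ := S.exists_ρE_of_mk_eq_mk (hy₁.trans hy₂.symm)
  exact Quot.sound (CovObj.ERel.mk _ g _)

/-- The comparison morphism is surjective on edges. [cite: MochizukiSemiAnbd2006, Prop 3.6 p.38] -/
theorem CovObj.univCoverOverEdge_surjective :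
    Function.Surjective (S.univCoverOverEdge c h𝒢) := by
  rintro ⟨E, p⟩
  obtain ⟨⟨e, y⟩, rfl⟩ := Quot.exists_rep E
  exact ⟨Quot.mk _ ⟨e, ⟨⟨Quot.mk _ ⟨e, y⟩, rfl⟩, ⟨y, rfl⟩, p⟩⟩, rfl⟩

/-- The comparison morphism is injective on branches. [cite: MochizukiSemiAnbd2006, Prop 3.6 p.38] -/
theorem CovObj.univCoverOverBranch_injective :
    Function.Injective (S.univCoverOverBranch c h𝒢) := by
  rintro ⟨⟨b₁, E₁⟩, h₁⟩ ⟨⟨b₂, E₂⟩, h₂⟩ h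
  have hb : b₁ = b₂ := congrArg (fun β : (S.orbitGraph.univCover c).Branch => β.2.1.1.1) h
  have hE : S.univCoverOverEdge c h𝒢 E₁ = S.univCoverOverEdge c h𝒢 E₂ :=
    congrArg (fun β : (S.orbitGraph.univCover c).Branch => β.1) h
  have hE' := S.univCoverOverEdge_injective c h𝒢 hE
  subst hb
  subst hE'
  rfl

/-- The comparison morphism is surjective on branches. [cite: MochizukiSemiAnbd2006, Prop 3.6 p.38] -/
theorem CovObj.univCoverOverBranch_surjective :
    Function.Surjective (S.univCoverOverBranch c h𝒢) := by
  rintro ⟨⟨E, p⟩, ⟨⟨b, E'⟩, hE'⟩, hEE⟩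
  change E' = E at hEE
  subst hEE
  obtain ⟨⟨e, y⟩, rfl⟩ := Quot.exists_rep E'
  change e = 𝒢.graph.edgeOf b at hE'
  subst hE'
  exact ⟨⟨(b, Quot.mk _ ⟨𝒢.graph.edgeOf b, ⟨⟨Quot.mk _ ⟨𝒢.graph.edgeOf b, y⟩, rfl⟩, ⟨y, rfl⟩, p⟩⟩),
    rfl⟩, rfl⟩

/-- The comparison morphism maps branches abutting to no vertex to branches abutting to no vertex
(both lie over a branch of `𝔾` abutting to no vertex). [cite: MochizukiSemiAnbd2006, Prop 3.6 p.38] -/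
theorem CovObj.univCover_abuts_univCoverOverBranch_of_none
    (β : (S.univCoverOver c h𝒢).orbitGraph.Branch)
    (hβ : (S.univCoverOver c h𝒢).orbitGraph.abuts β = none) :
    (S.orbitGraph.univCover c).abuts (S.univCoverOverBranch c h𝒢 β) = none := by
  obtain ⟨⟨b, E⟩, hE⟩ := β
  rcases hab : 𝒢.graph.abuts b with _ | v
  · exact SemiGraph.univCover_abuts_of_none S.orbitGraph c _ _ ⟨(b, _), _⟩ rfl
      (S.orbitGraph_abuts_of_none b _ _ hab)
  · exfalso
    obtain ⟨V, hV⟩ := Option.isSome_iff_exists.mp ((S.univCoverOver c h𝒢).glueOpt_isSome b v hab E hE)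
    rw [(S.univCoverOver c h𝒢).orbitGraph_abuts_of_abuts b E hE v hab, hV] at hβ
    cases hβ

/-- **(B5) The underlying semi-graph of `𝒢_{∞,S}` is the universal graph-covering `𝔾̃_S` of `𝔾_S`**:
`𝔾_{𝒢_{∞,S}} ≅ 𝔾̃_S` ([SemiAnbd] p. 38: `𝒢_{∞,i} → 𝒢_i` is "the covering of `𝒢_i` determined by the
universal graph-covering of the underlying semi-graph `𝔾_i` of `𝒢_i`").
[cite: MochizukiSemiAnbd2006, Prop 3.6 p.38] -/
noncomputable def CovObj.univCoverOverOrbitGraphIso :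
    (S.univCoverOver c h𝒢).orbitGraph ≅ S.orbitGraph.univCover c :=
  SemiGraph.Hom.isoOfBijective (S.univCoverOverToUnivCover c h𝒢)
    ⟨S.univCoverOverVertex_injective c h𝒢, S.univCoverOverVertex_surjective c h𝒢⟩
    ⟨S.univCoverOverEdge_injective c h𝒢, S.univCoverOverEdge_surjective c h𝒢⟩
    ⟨S.univCoverOverBranch_injective c h𝒢, S.univCoverOverBranch_surjective c h𝒢⟩
    (S.univCover_abuts_univCoverOverBranch_of_none c h𝒢)

/-- The `hom` of the identification is the comparison morphism. [cite: MochizukiSemiAnbd2006, Prop 3.6 p.38] -/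
@[simp] theorem CovObj.univCoverOverOrbitGraphIso_hom :
    (S.univCoverOverOrbitGraphIso c h𝒢).hom = S.univCoverOverToUnivCover c h𝒢 := rfl

/-! ### Naturality -/

/-- **The identification lies over `𝔾_S`**: composed with `𝔾̃_S → 𝔾_S` it is the morphism of underlying
semi-graphs induced by the projection `𝒢_{∞,S} → 𝒢_S`. [cite: MochizukiSemiAnbd2006, Prop 3.6 p.38] -/
theorem CovObj.univCoverOverToUnivCover_comp_univCoverProj :
    S.univCoverOverToUnivCover c h𝒢 ≫ S.orbitGraph.univCoverProj c =
      CovObj.orbitGraphMap (S.univCoverOverProj c h𝒢) := by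
  refine SemiGraph.hom_ext _ _ (funext fun V => ?_) (funext fun E => ?_) (funext fun β => ?_)
  · obtain ⟨⟨v, t⟩, rfl⟩ := Quot.exists_rep V
    exact t.2.1.2.symm
  · obtain ⟨⟨e, t⟩, rfl⟩ := Quot.exists_rep E
    exact t.2.1.2.symm
  · refine Subtype.ext (Prod.ext rfl ?_)
    obtain ⟨⟨e, t⟩, h⟩ := Quot.exists_rep β.1.2
    change (S.univCoverOverEdge c h𝒢 β.1.2).1 = CovObj.OEdge.map (S.univCoverOverProj c h𝒢) β.1.2
    rw [← h]
    exact t.2.1.2.symm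

/-- The identification lies over `𝔾`. [cite: MochizukiSemiAnbd2006, Prop 3.6 p.38] -/
theorem CovObj.univCoverOverToUnivCover_comp_proj :
    S.univCoverOverToUnivCover c h𝒢 ≫ S.orbitGraph.univCoverProj c ≫ S.orbitGraphProj =
      (S.univCoverOver c h𝒢).orbitGraphProj := by
  rw [← Category.assoc, S.univCoverOverToUnivCover_comp_univCoverProj c h𝒢,
    CovObj.orbitGraphMap_comp_proj]

/-- **Equivariance for the deck transformations**: the automorphism of `𝔾_{𝒢_{∞,S}}` underlying the
deck transformation `deckOver γ` of `𝒢_{∞,S}` (`γ ∈ π₁(𝔾_S, c)`) corresponds to the deck transformation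
`deck γ` of `𝔾̃_S` ("`Gal(𝒢_{∞,i}/𝒢_i) ≅ π₁(𝔾_i)`", p. 38). [cite: MochizukiSemiAnbd2006, Prop 3.6 p.38] -/
theorem CovObj.orbitGraphMap_deckOver_comp (γ : S.orbitGraph.FundamentalGroup c) :
    CovObj.orbitGraphMap (S.deckOver c h𝒢 γ) ≫ S.univCoverOverToUnivCover c h𝒢 =
      S.univCoverOverToUnivCover c h𝒢 ≫ S.orbitGraph.deck c γ := by
  refine SemiGraph.hom_ext _ _ (funext fun V => ?_) (funext fun E => ?_) (funext fun β => ?_)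
  · obtain ⟨⟨v, t⟩, rfl⟩ := Quot.exists_rep V
    rfl
  · obtain ⟨⟨e, t⟩, rfl⟩ := Quot.exists_rep E
    rfl
  · obtain ⟨⟨b, E⟩, hE⟩ := β
    obtain ⟨⟨e, t⟩, rfl⟩ := Quot.exists_rep E
    rfl

/-- **`Aut(𝒢_{∞,S})` acts on the tree `𝔾̃_S`**: an automorphism of `𝒢_{∞,S}` induces an automorphism of
its underlying semi-graph, transported to `𝔾̃_S` along the identification (the action through which
`π₁^temp(𝒢) = lim Aut(𝒢_{∞,i})` "acts on each of the `𝒢_{∞,i}`", p. 41).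
[cite: MochizukiSemiAnbd2006, Thm 3.7(iii) p.41] -/
noncomputable def CovObj.autUnivCover :
    Aut (S.univCoverOver c h𝒢) →* Aut (S.orbitGraph.univCover c) :=
  (S.univCoverOverOrbitGraphIso c h𝒢).conjAut.toMonoidHom.comp
    ((orbitGraphFunctor 𝒢).mapAut (S.univCoverOver c h𝒢))

/-- The automorphism of `𝔾̃_S` attached to `σ ∈ Aut(𝒢_{∞,S})`, on `hom`s: conjugate of the induced
automorphism of `𝔾_{𝒢_{∞,S}}` by the identification. [cite: MochizukiSemiAnbd2006, Thm 3.7(iii) p.41] -/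
theorem CovObj.autUnivCover_hom (σ : Aut (S.univCoverOver c h𝒢)) :
    (S.autUnivCover c h𝒢 σ).hom = (S.univCoverOverOrbitGraphIso c h𝒢).inv ≫
      CovObj.orbitGraphMap σ.hom ≫ S.univCoverOverToUnivCover c h𝒢 := by
  change ((S.univCoverOverOrbitGraphIso c h𝒢).conjAut
    ((orbitGraphFunctor 𝒢).mapAut (S.univCoverOver c h𝒢) σ)).hom = _
  rw [Iso.conjAut_hom]
  rfl

/-- The action of `Aut(𝒢_{∞,S})` on `𝔾̃_S` lies over `𝔾`. [cite: MochizukiSemiAnbd2006, Thm 3.7(iii) p.41] -/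
theorem CovObj.autUnivCover_hom_comp_proj (σ : Aut (S.univCoverOver c h𝒢)) :
    (S.autUnivCover c h𝒢 σ).hom ≫ S.orbitGraph.univCoverProj c ≫ S.orbitGraphProj =
      S.orbitGraph.univCoverProj c ≫ S.orbitGraphProj := by
  rw [S.autUnivCover_hom c h𝒢 σ, Category.assoc, Category.assoc,
    S.univCoverOverToUnivCover_comp_proj c h𝒢, CovObj.orbitGraphMap_comp_proj,
    ← S.univCoverOverToUnivCover_comp_proj c h𝒢, ← CovObj.univCoverOverOrbitGraphIso_hom,
    Iso.inv_hom_id_assoc]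

/-- **The deck transformations of `𝒢_{∞,S}` act on `𝔾̃_S` as the deck transformations of `𝔾̃_S`.**
[cite: MochizukiSemiAnbd2006, Prop 3.6 p.38] -/
theorem CovObj.autUnivCover_deckOverAut (γ : S.orbitGraph.FundamentalGroup c) :
    S.autUnivCover c h𝒢 (S.deckOverAut c h𝒢 γ) = SemiGraph.deckAut S.orbitGraph c γ := by
  ext1
  rw [S.autUnivCover_hom c h𝒢]
  change (S.univCoverOverOrbitGraphIso c h𝒢).inv ≫ CovObj.orbitGraphMap (S.deckOver c h𝒢 γ) ≫
    S.univCoverOverToUnivCover c h𝒢 = S.orbitGraph.deck c γ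
  rw [S.orbitGraphMap_deckOver_comp c h𝒢 γ, ← CovObj.univCoverOverOrbitGraphIso_hom,
    Iso.inv_hom_id_assoc]

/-! ### The underlying semi-graph of `𝒢_{∞,S}` is a tree -/

/-- **The underlying semi-graph of `𝒢_{∞,S}` is a tree** (it is isomorphic to the universal
graph-covering `𝔾̃_S`, a tree: abc-iut-L6-d4's `SemiGraph.univCover_isTree`).
[cite: MochizukiSemiAnbd2006, Thm 3.7(iii) p.41] -/
theorem CovObj.isTree_orbitGraph_univCoverOver : (S.univCoverOver c h𝒢).orbitGraph.IsTree :=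
  SemiGraph.IsTree.of_iso (S.univCoverOverOrbitGraphIso c h𝒢).symm
    (SemiGraph.univCover_isTree S.orbitGraph c)

/-- The underlying semi-graph of `𝒢_{∞,S}` is connected. [cite: MochizukiSemiAnbd2006, Prop 3.6 p.38] -/
theorem CovObj.isConnected_orbitGraph_univCoverOver :
    (S.univCoverOver c h𝒢).orbitGraph.IsConnected :=
  ⟨(S.isTree_orbitGraph_univCoverOver c h𝒢).isTree.connected⟩

end ProfiniteSemiGraph

end Literature.AnabelianGeometry.SemiGraphs
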